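import Summits.ResolutionOfSingularities.ResolutionOfSingularities.Theorems.PurelyInseparableDim4ResConeWeightLedgerPermanence
import Summits.ResolutionOfSingularities.ResolutionOfSingularities.Theorems.PurelyInseparableDim4ResConeLossFreeConstant
import HarnessLib
import HarnessLib.Audit.Tags

/-!
# Purely inseparable four-folds — THE LOSS MONITOR of the weight ledger: every constant-shade tail is EVENTUALLY LOSS-FREE (then its
# weights freeze at one legal lower-band state, res-dim4-p-2's theorem) OR LOSSY BEYOND EVERY INDEX (then a frozen-set certificate may use
# the loss verdict WITHOUT C13, i.e. for ANY polar rank — the power cones included), every prime `p`, every shade `d`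
# (cell `res-dim4-pi`, K2(p) lane, rung-1 generic brick FILE 5 — the kernel form of the holder's B-LF / B-LOSSY split; seat res-dim4-p-8 g6)

[OURS · counted 0 · cell `res-dim4-pi` · K2(p) lane (holder res-dim4-p-12 g5: B-row text S4 of 2026-08-29 11:07Z «ROW B-LF (loss-free power-cone
tails) / ROW B-LOSSY (power-cone tails that translate boundary letters infinitely often)»; DATUM «B-LF / B-LOSSY ledger split» bus l.6154) · seat
res-dim4-p-8 g6.]  **HONEST LABEL.**  BOOKKEEPING about OUR MODEL.  Nothing here proves any TAIL(p, d, e), K2(p), `NoIsolatedTrap p p`, CJS 6.40 or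
resolution of singularities in dimension ≥ 4 / characteristic `p` — NOT proved.  AI kernel work, weaker than expert review.

The frozen-set certificates of `…WeightLedgerPermanence` use the LOSS verdict `3` («no lossy legal edge inside the level») only for binary cones,
through C13 (`no_lossfree_tail`, `e_G ≡ 2`, `d < p`).  For ARBITRARY `e_G` the same verdict is honest on the LOSSY BRANCH of a trivial dichotomy:
* §1 **`exists_loss_monitor`** — along any sequence of states: either no late step is lossy, or lossy steps occur beyond every index (logic);
  on the chain, «not lossy at `k ≥ k₀`» is «no boundary letter translated» (`tail_lossy_iff`).
* §2 THE LOSS-FREE BRANCH (any `e_G`): **`lossfree_branch_frozen_state`** — res-dim4-p-2 g6's `lossfree_charted_weight` (p715775) gives a time `K₁`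
  from which the weight vector is CONSTANT and every chart letter weighs the newborn weight; the ledger adds that this frozen state is LEGAL and
  LOWER-BAND (the dock visits the lower band beyond every index, and the state no longer moves) — the entry positions of the window / slot games
  (at `p = 7`: the single-state B-LF residues of the DATUM, e.g. `(1,1)@(7,6)`, `(2,2),(1,1,1)@(7,5)`).
* §3 THE LOSSY BRANCH (any `e_G`): **`tail_confined_of_ledgerCheckPerm_lossy`** — with `hlossy : ∀ k₂, ∃ k ≥ k₂, Lossy r_k r_{k+1}` in place of
  `(hdp, he)`, `frozen_confinement_core`'s clause «verdict 3 ⇒ no late lossy edge» is contradicted directly, so a certificate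
  `∀ P, ledgerCheckPermAt p d ok h v P = true` whose tables use ALL verdicts `1…5+w` confines the tail to a LIVE level: the power-cone rows get
  the sharper (C13-style) residue lists on their lossy branch.
* §4 **`lossfree_or_confined_of_ledgerCheckPerm`** — the dichotomy assembled: every witnessed isolated above-floor constant-shade-`d` tail
  (any `e_G`) EITHER freezes at one legal lower-band weight vector from some time on, OR is lossy beyond every index and confined, with its frozen
  set, to a LIVE level of the certificate.
[cite: CossartJannsenSaito2020, Thm. 3.14] bears_on: LADDER-RESOLUTION:D157-DOOR2 (res-dim4-pi · K2(p) · weight ledger, loss monitor, rows B-LF / B-LOSSY).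
Supports stmt-ResolutionOfSingularities-16155 (helper).
-/

set_option linter.dupNamespace false -- mandated namespace of this single-conjunct summit

noncomputable section

namespace Summit.ResolutionOfSingularities.ResolutionOfSingularities.Theorems.PIDim4

namespace ResCone

open MvPolynomial Finset Literature.AlgebraicGeometry.Resolution
open Literature.AlgebraicGeometry.Resolution.CentreBlowup Literature.AlgebraicGeometry.Resolution.Hauser2010
open WeightLedger

/-! ## 1. The loss monitor -/

/-- **THE LOSS MONITOR** (pure logic): along any sequence of weight vectors, either no step after some `k₁ ≥ k₀` is lossy, or lossy steps occur
beyond every index. [folklore] -/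
theorem exists_loss_monitor (r : ℕ → Fin 4 → ℕ) (k₀ : ℕ) :
    (∃ k₁, k₀ ≤ k₁ ∧ ∀ k, k₁ ≤ k → ¬ Lossy (r k) (r (k + 1))) ∨ (∀ k₂, ∃ k, k₂ ≤ k ∧ Lossy (r k) (r (k + 1))) := by
  by_cases h : ∀ k₂, ∃ k, k₂ ≤ k ∧ Lossy (r k) (r (k + 1))
  · exact Or.inr h
  · push Not at h
    obtain ⟨k₂, hk₂⟩ := h
    exact Or.inl ⟨max k₀ k₂, le_max_left _ _, fun k hk hl => by
      obtain ⟨i, hi, h0⟩ := hl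
      exact hk₂ k (le_trans (le_max_right _ _) hk) i hi h0⟩

section Chain

variable {K : Type} [Field K] (p : ℕ) [Fact p.Prime] [CharP K p] [DecidableEq K]
  {c : ℕ → State K} {j : ℕ → Fin 4} {b : ℕ → Fin 4 → K}

/-! ## 2. The loss-free branch: the weights freeze at a legal lower-band state -/

/-- **THE LOSS-FREE BRANCH** (every prime `p`, every shade `d`, ANY `e_G`): if no step after `k₁ ≥ k₀` of a witnessed isolated above-floor
constant-shade-`d` tail is lossy in the ledger sense, then from some `K₁ ≥ k₁` on the weight vector is CONSTANT, equal to a LEGAL LOWER-BAND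
state, and every chart letter weighs the newborn weight `|r| + d − p` (res-dim4-p-2 g6's `lossfree_charted_weight` + `tail_ledger_legal` + the dock).
[OURS] [cite: CossartJannsenSaito2020, Thm. 3.14] -/
theorem lossfree_branch_frozen_state
    (hc : ∀ k, IsIsolated p (c k).F ∧ Step0 p (c k) (c (k + 1))) (hw : FreeTail.IsWitnessedChain p c j b)
    (hr0 : ∀ e ∈ (c 0).F.support, (c 0).r ≤ e) (hfloor : ∀ k, ordZero (c k).F ≠ p) {k₀ d : ℕ}
    (hshade : ∀ k, k₀ ≤ k → (c k).shade = (d : ℕ∞)) {k₁ : ℕ} (hk₁ : k₀ ≤ k₁)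
    (hlf : ∀ k, k₁ ≤ k → ¬ Lossy ⇑(c k).r ⇑(c (k + 1)).r) :
    ∃ K₁, k₁ ≤ K₁ ∧ Legal p d ⇑(c K₁).r ∧ LowerBand p d ⇑(c K₁).r ∧
      ∀ k, K₁ ≤ k → (c k).r = (c K₁).r ∧ (c k).r (j k) = wsum ⇑(c K₁).r + d - p := by
  -- loss-free in the chain's words
  have hloss : ∀ k, k₁ ≤ k → ∀ i, b k i ≠ 0 → (c k).r i = 0 := by
    intro k hk i hbi
    by_contra hri
    exact hlf k hk ((tail_lossy_iff p hc hw hr0 hfloor hshade (k := k) (by omega)).mp ⟨i, hbi, by omega⟩)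
  obtain ⟨K₀, hK₀, hconst⟩ := lossfree_charted_weight (p := p) hc hw hr0 hfloor (k₀ := k₁) (d := d)
    (fun k hk => hshade k (by omega)) hloss
  -- the weights are constant from `K₀`; pick a lower-band time `K₁ ≥ K₀`
  have hfix : ∀ k, K₀ ≤ k → (c k).r = (c K₀).r := by
    intro k hk
    obtain ⟨t, rfl⟩ := Nat.exists_eq_add_of_le hk
    induction t with
    | zero => rfl
    | succ t ih => rw [← ih (by omega), show K₀ + (t + 1) = K₀ + t + 1 by ring]; exact (hconst (K₀ + t) (by omega)).1
  obtain ⟨K₁, hK₁, hlow⟩ := exists_lowerBand_after p hc hw hr0 hfloor hshade (k₂ := K₀) (by omega)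
  refine ⟨K₁, by omega, tail_ledger_legal p hc hw hr0 hfloor hshade (by omega), hlow, fun k hk => ⟨?_, ?_⟩⟩
  · rw [hfix k (by omega), hfix K₁ hK₁]
  · rw [(hconst k (by omega)).2, wsum_coe, hfix k (by omega), hfix K₁ hK₁]

/-! ## 3. The lossy branch: the loss verdict needs no C13 -/

/-- **THE CERTIFICATE SOCKET WITH A FROZEN SET ON THE LOSSY BRANCH** (every prime `p`, every shade `d`, ANY `e_G`): if lossy ledger steps occur
beyond every index, a certificate `∀ P, ledgerCheckPermAt p d ok h v P = true` — with ALL verdicts allowed, including the loss verdict `3` — and the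
admissibility of `ok` confine the tail, with its frozen set, to a LIVE level. [OURS] [cite: CossartJannsenSaito2020, Thm. 3.14] -/
theorem tail_confined_of_ledgerCheckPerm_lossy
    (hc : ∀ k, IsIsolated p (c k).F ∧ Step0 p (c k) (c (k + 1))) (hw : FreeTail.IsWitnessedChain p c j b)
    (hr0 : ∀ e ∈ (c 0).F.support, (c 0).r ≤ e) (hfloor : ∀ k, ordZero (c k).F ≠ p) {k₀ d : ℕ}
    (hshade : ∀ k, k₀ ≤ k → (c k).shade = (d : ℕ∞)) (hlossy : ∀ k₂, ∃ k, k₂ ≤ k ∧ Lossy ⇑(c k).r ⇑(c (k + 1)).r)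
    {ok : (Fin 4 → Bool) → (Fin 4 → ℕ) → Bool} {h : (Fin 4 → Bool) → (Fin 4 → ℕ) → ℕ} {v : ℕ → ℕ}
    (H : ∀ P, ledgerCheckPermAt p d ok h v P = true)
    (hok : ∀ (P : Fin 4 → Bool) (k₁ : ℕ), k₀ ≤ k₁ → (∀ k, k₁ ≤ k → ∀ z, P z = true → j k ≠ z ∧ b k z = 0) →
      (∀ z, P z = false → ∀ k₂, ∃ k, k₂ ≤ k ∧ (j k = z ∨ b k z ≠ 0)) → ∃ k₂, k₁ ≤ k₂ ∧ ∀ k, k₂ ≤ k → ok P ⇑(c k).r = true) :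
    ∃ (P : Fin 4 → Bool) (i k₂ : ℕ), v i = 0 ∧ k₀ ≤ k₂ ∧ (∀ k, k₂ ≤ k → Legal p d ⇑(c k).r ∧ ok P ⇑(c k).r = true ∧ h P ⇑(c k).r = i) ∧
      (∀ k, k₂ ≤ k → ∀ z, P z = true → j k ≠ z ∧ b k z = 0) ∧ (∀ z, P z = false → ∀ k₃, ∃ k, k₃ ≤ k ∧ (j k = z ∨ b k z ≠ 0)) := by
  obtain ⟨P, i, k₂, hk₂, hlev, hfrozen, hhit, hvle, h1, h2, h4, h5, h3⟩ := frozen_confinement_core p hc hw hr0 hfloor hshade H hok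
  refine ⟨P, i, k₂, ?_, hk₂, hlev, hfrozen, hhit⟩
  have h3' : v i ≠ 3 := fun hv3 => by
    obtain ⟨k, hk, hl⟩ := hlossy k₂
    exact h3 hv3 k hk hl
  omega

/-! ## 4. The dichotomy -/

/-- **LOSS-FREE OR CONFINED** (every prime `p`, every shade `d`, ANY `e_G` — the kernel form of the B-LF / B-LOSSY split): given a frozen-set
certificate with all verdicts and an admissible `ok`, every witnessed isolated above-floor constant-shade-`d` tail EITHER freezes at one legal
lower-band weight vector whose chart letters weigh the newborn weight (loss-free branch), OR is lossy beyond every index and confined, with its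
frozen set, to a LIVE level of the certificate. [OURS] [cite: CossartJannsenSaito2020, Thm. 3.14] -/
theorem lossfree_or_confined_of_ledgerCheckPerm
    (hc : ∀ k, IsIsolated p (c k).F ∧ Step0 p (c k) (c (k + 1))) (hw : FreeTail.IsWitnessedChain p c j b)
    (hr0 : ∀ e ∈ (c 0).F.support, (c 0).r ≤ e) (hfloor : ∀ k, ordZero (c k).F ≠ p) {k₀ d : ℕ}
    (hshade : ∀ k, k₀ ≤ k → (c k).shade = (d : ℕ∞))
    {ok : (Fin 4 → Bool) → (Fin 4 → ℕ) → Bool} {h : (Fin 4 → Bool) → (Fin 4 → ℕ) → ℕ} {v : ℕ → ℕ}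
    (H : ∀ P, ledgerCheckPermAt p d ok h v P = true)
    (hok : ∀ (P : Fin 4 → Bool) (k₁ : ℕ), k₀ ≤ k₁ → (∀ k, k₁ ≤ k → ∀ z, P z = true → j k ≠ z ∧ b k z = 0) →
      (∀ z, P z = false → ∀ k₂, ∃ k, k₂ ≤ k ∧ (j k = z ∨ b k z ≠ 0)) → ∃ k₂, k₁ ≤ k₂ ∧ ∀ k, k₂ ≤ k → ok P ⇑(c k).r = true) :
    (∃ K₁, k₀ ≤ K₁ ∧ Legal p d ⇑(c K₁).r ∧ LowerBand p d ⇑(c K₁).r ∧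
      ∀ k, K₁ ≤ k → (c k).r = (c K₁).r ∧ (c k).r (j k) = wsum ⇑(c K₁).r + d - p) ∨
    (∃ (P : Fin 4 → Bool) (i k₂ : ℕ), v i = 0 ∧ k₀ ≤ k₂ ∧ (∀ k, k₂ ≤ k → Legal p d ⇑(c k).r ∧ ok P ⇑(c k).r = true ∧ h P ⇑(c k).r = i) ∧
      (∀ k, k₂ ≤ k → ∀ z, P z = true → j k ≠ z ∧ b k z = 0) ∧ (∀ z, P z = false → ∀ k₃, ∃ k, k₃ ≤ k ∧ (j k = z ∨ b k z ≠ 0))) := by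
  rcases exists_loss_monitor (fun k => ⇑(c k).r) k₀ with ⟨k₁, hk₁, hlf⟩ | hlossy
  · obtain ⟨K₁, hK₁, hleg, hlow, hconst⟩ := lossfree_branch_frozen_state p hc hw hr0 hfloor hshade hk₁ hlf
    exact Or.inl ⟨K₁, by omega, hleg, hlow, hconst⟩
  · exact Or.inr (tail_confined_of_ledgerCheckPerm_lossy p hc hw hr0 hfloor hshade hlossy H hok)

end Chain

end ResCone

end Summit.ResolutionOfSingularities.ResolutionOfSingularities.Theorems.PIDim4

end
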